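import Summits.RiemannHypothesis.RiemannHypothesis.Theorems.WeilCombCombShapeDetection
import Literature.NumberTheory.LFunctions.WeilCriterionConverse
import Literature.NumberTheory.LFunctions.WeilExplicitFormulaProofs
import HarnessLib

/-!
# The off-line part of Weil's form: the exact split over the zero pairs `{ρ, 1 − ρ̄}`

Structure seat rh-explicit-weil-3 (gen6), supporting `stmt-RiemannHypothesis-0098`
(`∀ a > 0, WeilPositivityOn a`). Everything here is PROVED (no named facts); normalisation of
`Literature/NumberTheory/LFunctions/WeilExplicit.lean`: `ĝ = weilMellin g`,
`Q(g) = weilQuadratic g = W(g ⋆ g̃)`, `m(ρ) = riemannZetaZeroOrder ρ`, the non-trivial zeros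
`ZetaZeros.riemannZetaNontrivialZeros` (`0 < Re ρ < 1`), `ρ* = 1 − ρ̄` (the reflection in the
critical line; `ρ* = ρ` iff `Re ρ = 1/2`), `C_g = weilDecayConst g = ∫ (‖g‖ + ‖g''‖) e^{|x|/2}`.
For a test function `g` write `a = ĝ(ρ)`, `b = ĝ(ρ*)`; the LINE part is `(a + b)/2`, the
OFF-LINE part is `(a − b)/2`.

1. `weilMellin_sub_reflect` — **`ĝ(ρ) − ĝ(ρ*) = 2 ∫ g(x) sinh((Re ρ − 1/2) x) e^{i Im ρ · x} dx`**:
   a window sees the horizontal displacement `β − 1/2` of a zero only through the odd weight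
   `sinh((β − 1/2)x)` on its own support; it vanishes when `Re ρ = 1/2`
   (`weilMellin_sub_reflect_eq_zero`); `‖a − b‖ ≤ 2 C_g/(1 + (Im ρ)²)` at a non-trivial zero
   (`norm_weilMellin_sub_reflect_le_decay`; the window bound `2 sinh(|Re ρ − 1/2| t) ∫‖g‖` is in
   `WeilOffLineNoLever.lean`).
2. `re_weilQuadratic_eq_tsum_sub_tsum` — **the exact split**:
   `Re Q(g) = ∑_ρ m(ρ) ‖(a+b)/2‖² − ∑_ρ m(ρ) ‖(a−b)/2‖²` (both series absolutely convergent), from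
   the explicit formula `Q(g) = ∑_ρ m(ρ) ĝ(ρ) conj ĝ(ρ*)` (`explicit_formula_holds`,
   `WeilConverse.hasWeilZeroSide_zeroForm`), the symmetry `m(ρ*) = m(ρ)`
   (`riemannZetaZeroOrder_one_sub_conj`) and the parallelogram law
   `Re P(ρ) + Re P(ρ*) = 2 Re(a b̄) = (‖a+b‖² − ‖a−b‖²)/2`. On the line the first summand is
   `m(ρ)‖ĝ(ρ)‖²` and the second is `0`: the second series is carried by the OFF-LINE zeros alone.
3. `neg_tsum_le_re_weilQuadratic` — **the budget**: `−∑_ρ m(ρ) ‖(a−b)/2‖² ≤ Re Q(g)`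
   (and `Re Q(g) ≤ ∑_ρ m(ρ) ‖(a+b)/2‖²`). Negativity of Weil's form can only be produced by
   off-line zeros, each entering through the `sinh`-transform of `g`. The quantitative corollary
   above a verified height is in `WeilOffLineNoLever.lean`.

References: A. Weil 1952; E. Bombieri, *Remarks on Weil's quadratic functional… I*, Rend. Lincei
(9) 11 (2000) 183–233, §3 (zero side `∑ g̃(ρ) conj g̃(1−ρ̄)`) and §13 (numerical critical support
`t_c` for a fictitious off-line zero); H. Yoshida 1992, Prop. 1 (odd/even sectors). The split and
the budget are elementary but not in these sources as far as searched (corpus fts+vec, galaxy).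
-/

noncomputable section

set_option linter.dupNamespace false  -- the mandated namespace repeats `RiemannHypothesis`

open Complex Filter Set MeasureTheory Topology
open scoped Real ComplexConjugate

namespace Summit.RiemannHypothesis.RiemannHypothesis.Theorems.WeilOffLine

open Literature.NumberTheory.LFunctions Literature.NumberTheory.LFunctions.WeilConverse

/-! ### The off-line part of the transform

The identification `WeilConverse.zeroForm g = weilQuadratic g` (explicit formula + uniqueness of
the symmetric limit) is the tree's `combShapeDetection_zeroForm_eq_weilQuadratic`. -/

/-- The exponent of `ĝ` at `ρ`: `(ρ − 1/2)·x = (Re ρ − 1/2)x + i (Im ρ) x`. [folklore] -/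
theorem sub_half_mul_eq (ρ : ℂ) (x : ℝ) :
    (ρ - 1 / 2) * (x : ℂ) = (((ρ.re - 1 / 2) * x : ℝ) : ℂ) + ((ρ.im * x : ℝ) : ℂ) * I := by
  apply Complex.ext
  · simp
  · simp

/-- The exponent of `ĝ` at the reflected point `ρ* = 1 − ρ̄`:
`(ρ* − 1/2)·x = −(Re ρ − 1/2)x + i (Im ρ) x`. [folklore] -/
theorem reflect_sub_half_mul_eq (ρ : ℂ) (x : ℝ) :
    (1 - conj ρ - 1 / 2) * (x : ℂ) = -(((ρ.re - 1 / 2) * x : ℝ) : ℂ) + ((ρ.im * x : ℝ) : ℂ) * I := by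
  apply Complex.ext
  · simp; ring
  · simp

/-- `e^{(ρ−1/2)x} − e^{(ρ*−1/2)x} = 2 sinh((Re ρ − 1/2)x) e^{i Im ρ x}`. [folklore] -/
theorem cexp_sub_cexp_reflect (ρ : ℂ) (x : ℝ) :
    cexp ((ρ - 1 / 2) * (x : ℂ)) - cexp ((1 - conj ρ - 1 / 2) * (x : ℂ)) =
      2 * ((Real.sinh ((ρ.re - 1 / 2) * x) : ℝ) : ℂ) * cexp (((ρ.im * x : ℝ) : ℂ) * I) := by
  rw [sub_half_mul_eq, reflect_sub_half_mul_eq, Complex.exp_add, Complex.exp_add,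
    Complex.ofReal_sinh, Complex.sinh]
  ring

/-- **The off-line part as a `sinh`-transform**:
`ĝ(ρ) − ĝ(1 − ρ̄) = 2 ∫ g(x) sinh((Re ρ − 1/2) x) e^{i Im ρ x} dx` for every continuous compactly
supported `g` and every `ρ : ℂ`. The weight `sinh((β − 1/2)x)` is odd in `x` and vanishes
identically when `β = 1/2`. [folklore] -/
theorem weilMellin_sub_reflect {g : ℝ → ℂ} (hgc : Continuous g) (hgs : HasCompactSupport g)
    (ρ : ℂ) :
    weilMellin g ρ - weilMellin g (1 - conj ρ) =
      2 * ∫ x : ℝ, g x * ((Real.sinh ((ρ.re - 1 / 2) * x) : ℝ) : ℂ) *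
        cexp (((ρ.im * x : ℝ) : ℂ) * I) := by
  unfold weilMellin
  rw [← integral_sub (integrable_weilIntegrand hgc hgs ρ) (integrable_weilIntegrand hgc hgs _),
    ← integral_const_mul]
  refine integral_congr_ae (Eventually.of_forall fun x ↦ ?_)
  simp only
  rw [← mul_sub, cexp_sub_cexp_reflect]
  ring

/-- On the critical line the off-line part vanishes: `Re ρ = 1/2 ⇒ ĝ(ρ) − ĝ(1 − ρ̄) = 0`
(indeed `1 − ρ̄ = ρ`). [folklore] -/
theorem weilMellin_sub_reflect_eq_zero (g : ℝ → ℂ) {ρ : ℂ} (hρ : ρ.re = 1 / 2) :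
    weilMellin g ρ - weilMellin g (1 - conj ρ) = 0 := by
  have h1 : 1 - conj ρ = ρ := by
    apply Complex.ext
    · simp only [sub_re, one_re, conj_re, hρ]; norm_num
    · simp
  rw [h1, sub_self]

/-- On the critical line the line part is the transform itself: `Re ρ = 1/2 ⇒ ĝ(ρ) + ĝ(1 − ρ̄) = 2 ĝ(ρ)`,
so that the `ρ`-term of the line series is `m(ρ)‖ĝ(ρ)‖²`. [folklore] -/
theorem weilMellin_add_reflect_eq (g : ℝ → ℂ) {ρ : ℂ} (hρ : ρ.re = 1 / 2) :
    weilMellin g ρ + weilMellin g (1 - conj ρ) = 2 * weilMellin g ρ := by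
  have h1 : 1 - conj ρ = ρ := by
    apply Complex.ext
    · simp only [sub_re, one_re, conj_re, hρ]; norm_num
    · simp
  rw [h1, two_mul]

/-- Decay of the transform at the reflected point of a non-trivial zero:
`‖ĝ(1 − ρ̄)‖ ≤ C_g/(1 + (Im ρ)²)` (`Re (1 − ρ̄) = 1 − Re ρ ∈ [0, 1]`, `Im (1 − ρ̄) = Im ρ`).
[folklore] -/
theorem norm_weilMellin_reflect_le_decay {g : ℝ → ℂ} (hg : IsWeilTest g) {ρ : ℂ}
    (hρ : ρ ∈ ZetaZeros.riemannZetaNontrivialZeros) :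
    ‖weilMellin g (1 - conj ρ)‖ ≤ weilDecayConst g / (1 + ρ.im ^ 2) := by
  have h0 := ZetaZeros.riemannZetaNontrivialZeros.re_pos hρ
  have h1 := ZetaZeros.riemannZetaNontrivialZeros.re_lt_one hρ
  have := norm_weilMellin_le hg (s := 1 - conj ρ)
    (by rw [one_sub_conj_re]; linarith) (by rw [one_sub_conj_re]; linarith)
  rwa [one_sub_conj_im] at this

/-- **Strip bound for the off-line part**: at a non-trivial zero `ρ`,
`‖ĝ(ρ) − ĝ(1 − ρ̄)‖ ≤ 2 C_g/(1 + (Im ρ)²)` (`norm_weilMellin_le` at `ρ` and at `1 − ρ̄`).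
[folklore] -/
theorem norm_weilMellin_sub_reflect_le_decay {g : ℝ → ℂ} (hg : IsWeilTest g) {ρ : ℂ}
    (hρ : ρ ∈ ZetaZeros.riemannZetaNontrivialZeros) :
    ‖weilMellin g ρ - weilMellin g (1 - conj ρ)‖ ≤ 2 * (weilDecayConst g / (1 + ρ.im ^ 2)) := by
  have h1 := norm_weilMellin_le hg (ZetaZeros.riemannZetaNontrivialZeros.re_pos hρ).le
    (ZetaZeros.riemannZetaNontrivialZeros.re_lt_one hρ).le
  linarith [norm_sub_le (weilMellin g ρ) (weilMellin g (1 - conj ρ)),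
    norm_weilMellin_reflect_le_decay hg hρ]

/-- The line part is bounded likewise: `‖ĝ(ρ) + ĝ(1 − ρ̄)‖ ≤ 2 C_g/(1 + (Im ρ)²)` at a
non-trivial zero. [folklore] -/
theorem norm_weilMellin_add_reflect_le_decay {g : ℝ → ℂ} (hg : IsWeilTest g) {ρ : ℂ}
    (hρ : ρ ∈ ZetaZeros.riemannZetaNontrivialZeros) :
    ‖weilMellin g ρ + weilMellin g (1 - conj ρ)‖ ≤ 2 * (weilDecayConst g / (1 + ρ.im ^ 2)) := by
  have h1 := norm_weilMellin_le hg (ZetaZeros.riemannZetaNontrivialZeros.re_pos hρ).le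
    (ZetaZeros.riemannZetaNontrivialZeros.re_lt_one hρ).le
  linarith [norm_add_le (weilMellin g ρ) (weilMellin g (1 - conj ρ)),
    norm_weilMellin_reflect_le_decay hg hρ]

/-! ### The parallelogram split of the pair terms -/

/-- The pair term at the reflected zero: `P_g(1 − ρ̄) = ĝ(1 − ρ̄) · conj ĝ(ρ)`
(`1 − conj (1 − conj ρ) = ρ`). [cite: Bombieri2000Weil, §3] -/
theorem pairCoeff_reflect (g : ℝ → ℂ) (ρ : ℂ) :
    pairCoeff g (1 - conj ρ) = weilMellin g (1 - conj ρ) * conj (weilMellin g ρ) := by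
  rw [pairCoeff]
  congr 2
  simp

/-- **Parallelogram identity for a zero pair**:
`Re P_g(ρ) + Re P_g(1 − ρ̄) = (‖ĝ(ρ) + ĝ(1−ρ̄)‖² − ‖ĝ(ρ) − ĝ(1−ρ̄)‖²)/2` (`= 2 Re(a b̄)` with
`a = ĝ(ρ)`, `b = ĝ(1 − ρ̄)`). [folklore] -/
theorem re_pairCoeff_add_re_pairCoeff_reflect (g : ℝ → ℂ) (ρ : ℂ) :
    (pairCoeff g ρ).re + (pairCoeff g (1 - conj ρ)).re =
      (‖weilMellin g ρ + weilMellin g (1 - conj ρ)‖ ^ 2 -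
        ‖weilMellin g ρ - weilMellin g (1 - conj ρ)‖ ^ 2) / 2 := by
  rw [pairCoeff_reflect, pairCoeff]
  set a := weilMellin g ρ
  set b := weilMellin g (1 - conj ρ)
  rw [← Complex.normSq_eq_norm_sq, ← Complex.normSq_eq_norm_sq, Complex.normSq_add,
    Complex.normSq_sub]
  simp only [Complex.mul_re, Complex.conj_re, Complex.conj_im]
  ring

/-- The same identity with the halves: `m Re P(ρ) + m Re P(1 − ρ̄) = 2 (m‖(a+b)/2‖² − m‖(a−b)/2‖²)`.
[folklore] -/
theorem pair_terms_eq (g : ℝ → ℂ) (ρ : ℂ) (m : ℝ) :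
    m * (pairCoeff g ρ).re + m * (pairCoeff g (1 - conj ρ)).re =
      2 * (m * ‖(weilMellin g ρ + weilMellin g (1 - conj ρ)) / 2‖ ^ 2 -
        m * ‖(weilMellin g ρ - weilMellin g (1 - conj ρ)) / 2‖ ^ 2) := by
  rw [← mul_add, re_pairCoeff_add_re_pairCoeff_reflect, norm_div, norm_div, Complex.norm_ofNat]
  ring

/-! ### Summability of the two halves -/

/-- Comparison with the summable weight: a family `m(ρ) x(ρ)` with `0 ≤ x(ρ) ≤ K/(1+γ²)²` is
summable over the non-trivial zeros (`weilZeroSummable`). [folklore] -/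
theorem summable_zeroOrder_mul_of_le {x : ℂ → ℝ} {K : ℝ}
    (hx0 : ∀ ρ ∈ ZetaZeros.riemannZetaNontrivialZeros, 0 ≤ x ρ)
    (hx : ∀ ρ ∈ ZetaZeros.riemannZetaNontrivialZeros, x ρ ≤ K / (1 + ρ.im ^ 2) ^ 2) :
    Summable fun ρ : ZetaZeros.riemannZetaNontrivialZeros ↦
      (riemannZetaZeroOrder (ρ : ℂ) : ℝ) * x ρ := by
  refine Summable.of_nonneg_of_le (fun ρ ↦ mul_nonneg (by exact_mod_cast riemannZetaZeroOrder_nonneg (ZetaZeros.riemannZetaNontrivialZeros.ne_one ρ.2) : (0 : ℝ) ≤ riemannZetaZeroOrder (ρ : ℂ)) (hx0 ρ ρ.2))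
    (fun ρ ↦ ?_) (weilZeroSummable.mul_left K)
  rw [weilZeroWeight]
  calc (riemannZetaZeroOrder (ρ : ℂ) : ℝ) * x ρ
      ≤ (riemannZetaZeroOrder (ρ : ℂ) : ℝ) * (K / (1 + (ρ : ℂ).im ^ 2) ^ 2) :=
        mul_le_mul_of_nonneg_left (hx ρ ρ.2) (by exact_mod_cast riemannZetaZeroOrder_nonneg (ZetaZeros.riemannZetaNontrivialZeros.ne_one ρ.2) : (0 : ℝ) ≤ riemannZetaZeroOrder (ρ : ℂ))
    _ = K * ((riemannZetaZeroOrder (ρ : ℂ) : ℝ) / (1 + (ρ : ℂ).im ^ 2) ^ 2) := by ring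

/-- The OFF-LINE series `∑ m(ρ) ‖(ĝ(ρ) − ĝ(1−ρ̄))/2‖²` converges. [folklore] -/
theorem summable_offLine {g : ℝ → ℂ} (hg : IsWeilTest g) :
    Summable fun ρ : ZetaZeros.riemannZetaNontrivialZeros ↦
      (riemannZetaZeroOrder (ρ : ℂ) : ℝ) *
        ‖(weilMellin g ρ - weilMellin g (1 - conj (ρ : ℂ))) / 2‖ ^ 2 := by
  refine summable_zeroOrder_mul_of_le
    (x := fun ρ ↦ ‖(weilMellin g ρ - weilMellin g (1 - conj ρ)) / 2‖ ^ 2)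
    (K := weilDecayConst g ^ 2) (fun ρ _ ↦ sq_nonneg _) fun ρ hρ ↦ ?_
  have h := norm_weilMellin_sub_reflect_le_decay hg hρ
  have h' : ‖(weilMellin g ρ - weilMellin g (1 - conj ρ)) / 2‖ ≤
      weilDecayConst g / (1 + ρ.im ^ 2) := by
    rw [norm_div, Complex.norm_ofNat]; linarith
  calc ‖(weilMellin g ρ - weilMellin g (1 - conj ρ)) / 2‖ ^ 2
      ≤ (weilDecayConst g / (1 + ρ.im ^ 2)) ^ 2 := pow_le_pow_left₀ (norm_nonneg _) h' 2
    _ = weilDecayConst g ^ 2 / (1 + ρ.im ^ 2) ^ 2 := by rw [div_pow]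

/-- The LINE series `∑ m(ρ) ‖(ĝ(ρ) + ĝ(1−ρ̄))/2‖²` converges. [folklore] -/
theorem summable_line {g : ℝ → ℂ} (hg : IsWeilTest g) :
    Summable fun ρ : ZetaZeros.riemannZetaNontrivialZeros ↦
      (riemannZetaZeroOrder (ρ : ℂ) : ℝ) *
        ‖(weilMellin g ρ + weilMellin g (1 - conj (ρ : ℂ))) / 2‖ ^ 2 := by
  refine summable_zeroOrder_mul_of_le
    (x := fun ρ ↦ ‖(weilMellin g ρ + weilMellin g (1 - conj ρ)) / 2‖ ^ 2)
    (K := weilDecayConst g ^ 2) (fun ρ _ ↦ sq_nonneg _) fun ρ hρ ↦ ?_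
  have h := norm_weilMellin_add_reflect_le_decay hg hρ
  have h' : ‖(weilMellin g ρ + weilMellin g (1 - conj ρ)) / 2‖ ≤
      weilDecayConst g / (1 + ρ.im ^ 2) := by
    rw [norm_div, Complex.norm_ofNat]; linarith
  calc ‖(weilMellin g ρ + weilMellin g (1 - conj ρ)) / 2‖ ^ 2
      ≤ (weilDecayConst g / (1 + ρ.im ^ 2)) ^ 2 := pow_le_pow_left₀ (norm_nonneg _) h' 2
    _ = weilDecayConst g ^ 2 / (1 + ρ.im ^ 2) ^ 2 := by rw [div_pow]

/-! ### The exact split and the budget -/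

/-- `Re Q(g) = ∑_ρ m(ρ) Re P_g(ρ)` (real part of the absolutely convergent zero side).
[cite: Bombieri2000Weil, Thm. 1] -/
theorem re_weilQuadratic_eq_tsum_re_pairCoeff {g : ℝ → ℂ} (hg : IsWeilTest g) :
    (weilQuadratic g).re =
      ∑' ρ : ZetaZeros.riemannZetaNontrivialZeros,
        (riemannZetaZeroOrder (ρ : ℂ) : ℝ) * (pairCoeff g ρ).re := by
  rw [← combShapeDetection_zeroForm_eq_weilQuadratic hg, zeroForm, Complex.re_tsum (summable_pairCoeff hg)]
  refine tsum_congr fun ρ ↦ ?_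
  simp [Complex.mul_re]

/-- The series `∑_ρ m(ρ) Re P_g(ρ)` converges. [folklore] -/
theorem summable_re_pairCoeff {g : ℝ → ℂ} (hg : IsWeilTest g) :
    Summable fun ρ : ZetaZeros.riemannZetaNontrivialZeros ↦
      (riemannZetaZeroOrder (ρ : ℂ) : ℝ) * (pairCoeff g ρ).re := by
  have := (summable_pairCoeff hg).mapL Complex.reCLM
  refine this.congr fun ρ ↦ ?_
  simp [Complex.mul_re]

/-- The reflected series `∑_ρ m(ρ) Re P_g(1 − ρ̄)` is the same series re-indexed by the
involution `ρ ↦ 1 − ρ̄` of the non-trivial zeros (which preserves multiplicities,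
`riemannZetaZeroOrder_one_sub_conj`); in particular it converges and has the same sum. [folklore] -/
theorem reflect_term_eq (g : ℝ → ℂ) (σ : ZetaZeros.riemannZetaNontrivialZeros) :
    (riemannZetaZeroOrder ((reflectEquiv σ : ZetaZeros.riemannZetaNontrivialZeros) : ℂ) : ℝ) *
        (pairCoeff g ((reflectEquiv σ : ZetaZeros.riemannZetaNontrivialZeros) : ℂ)).re =
      (riemannZetaZeroOrder (σ : ℂ) : ℝ) * (pairCoeff g (1 - conj (σ : ℂ))).re := by
  have h0 := ZetaZeros.riemannZetaNontrivialZeros.re_pos σ.2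
  have h1 := ZetaZeros.riemannZetaNontrivialZeros.re_lt_one σ.2
  have hm : riemannZetaZeroOrder (1 - conj (σ : ℂ)) = riemannZetaZeroOrder (σ : ℂ) :=
    riemannZetaZeroOrder_one_sub_conj h0 h1
  show (riemannZetaZeroOrder ((reflect σ : ZetaZeros.riemannZetaNontrivialZeros) : ℂ) : ℝ) *
      (pairCoeff g ((reflect σ : ZetaZeros.riemannZetaNontrivialZeros) : ℂ)).re = _
  rw [coe_reflect, hm]

/-- Summability of the reflected series. [folklore] -/
theorem summable_re_pairCoeff_reflect {g : ℝ → ℂ} (hg : IsWeilTest g) :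
    Summable fun ρ : ZetaZeros.riemannZetaNontrivialZeros ↦
      (riemannZetaZeroOrder (ρ : ℂ) : ℝ) * (pairCoeff g (1 - conj (ρ : ℂ))).re := by
  have h := (reflectEquiv.summable_iff (f := fun ρ : ZetaZeros.riemannZetaNontrivialZeros ↦
    (riemannZetaZeroOrder (ρ : ℂ) : ℝ) * (pairCoeff g ρ).re)).2 (summable_re_pairCoeff hg)
  refine h.congr fun σ ↦ ?_
  exact reflect_term_eq g σ

/-- `∑_ρ m(ρ) Re P_g(ρ) = ∑_ρ m(ρ) Re P_g(1 − ρ̄)`. [folklore] -/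
theorem tsum_re_pairCoeff_eq_tsum_reflect (g : ℝ → ℂ) :
    ∑' ρ : ZetaZeros.riemannZetaNontrivialZeros,
        (riemannZetaZeroOrder (ρ : ℂ) : ℝ) * (pairCoeff g ρ).re =
      ∑' ρ : ZetaZeros.riemannZetaNontrivialZeros,
        (riemannZetaZeroOrder (ρ : ℂ) : ℝ) * (pairCoeff g (1 - conj (ρ : ℂ))).re := by
  rw [← Equiv.tsum_eq reflectEquiv (fun ρ : ZetaZeros.riemannZetaNontrivialZeros ↦
    (riemannZetaZeroOrder (ρ : ℂ) : ℝ) * (pairCoeff g ρ).re)]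
  exact tsum_congr fun σ ↦ reflect_term_eq g σ

/-- **THE EXACT SPLIT of Weil's form over the zero pairs `{ρ, 1 − ρ̄}`**:
`Re Q(g) = ∑_ρ m(ρ) ‖(ĝ(ρ) + ĝ(1−ρ̄))/2‖² − ∑_ρ m(ρ) ‖(ĝ(ρ) − ĝ(1−ρ̄))/2‖²`
for every test function `g` (both series over all non-trivial zeros with multiplicity, absolutely
convergent). On the critical line the first summand is `m(ρ)‖ĝ(ρ)‖²` and the second is `0`; the
second series is carried by the off-line zeros alone. [folklore] -/
theorem re_weilQuadratic_eq_tsum_sub_tsum {g : ℝ → ℂ} (hg : IsWeilTest g) :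
    (weilQuadratic g).re =
      (∑' ρ : ZetaZeros.riemannZetaNontrivialZeros,
        (riemannZetaZeroOrder (ρ : ℂ) : ℝ) *
          ‖(weilMellin g ρ + weilMellin g (1 - conj (ρ : ℂ))) / 2‖ ^ 2) -
      ∑' ρ : ZetaZeros.riemannZetaNontrivialZeros,
        (riemannZetaZeroOrder (ρ : ℂ) : ℝ) *
          ‖(weilMellin g ρ - weilMellin g (1 - conj (ρ : ℂ))) / 2‖ ^ 2 := by
  have hS := summable_re_pairCoeff hg
  have hS' := summable_re_pairCoeff_reflect hg
  have hL := summable_line hg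
  have hD := summable_offLine hg
  have h2 : 2 * (weilQuadratic g).re =
      2 * ((∑' ρ : ZetaZeros.riemannZetaNontrivialZeros,
        (riemannZetaZeroOrder (ρ : ℂ) : ℝ) *
          ‖(weilMellin g ρ + weilMellin g (1 - conj (ρ : ℂ))) / 2‖ ^ 2) -
      ∑' ρ : ZetaZeros.riemannZetaNontrivialZeros,
        (riemannZetaZeroOrder (ρ : ℂ) : ℝ) *
          ‖(weilMellin g ρ - weilMellin g (1 - conj (ρ : ℂ))) / 2‖ ^ 2) := by
    calc 2 * (weilQuadratic g).re
        = (∑' ρ : ZetaZeros.riemannZetaNontrivialZeros,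
            (riemannZetaZeroOrder (ρ : ℂ) : ℝ) * (pairCoeff g ρ).re) +
          ∑' ρ : ZetaZeros.riemannZetaNontrivialZeros,
            (riemannZetaZeroOrder (ρ : ℂ) : ℝ) * (pairCoeff g (1 - conj (ρ : ℂ))).re := by
          rw [two_mul, re_weilQuadratic_eq_tsum_re_pairCoeff hg, ← tsum_re_pairCoeff_eq_tsum_reflect]
      _ = ∑' ρ : ZetaZeros.riemannZetaNontrivialZeros,
            ((riemannZetaZeroOrder (ρ : ℂ) : ℝ) * (pairCoeff g ρ).re +
              (riemannZetaZeroOrder (ρ : ℂ) : ℝ) * (pairCoeff g (1 - conj (ρ : ℂ))).re) :=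
          (hS.tsum_add hS').symm
      _ = ∑' ρ : ZetaZeros.riemannZetaNontrivialZeros,
            2 * ((riemannZetaZeroOrder (ρ : ℂ) : ℝ) *
                ‖(weilMellin g ρ + weilMellin g (1 - conj (ρ : ℂ))) / 2‖ ^ 2 -
              (riemannZetaZeroOrder (ρ : ℂ) : ℝ) *
                ‖(weilMellin g ρ - weilMellin g (1 - conj (ρ : ℂ))) / 2‖ ^ 2) :=
          tsum_congr fun ρ ↦ pair_terms_eq g ρ _
      _ = 2 * ∑' ρ : ZetaZeros.riemannZetaNontrivialZeros,
            ((riemannZetaZeroOrder (ρ : ℂ) : ℝ) *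
                ‖(weilMellin g ρ + weilMellin g (1 - conj (ρ : ℂ))) / 2‖ ^ 2 -
              (riemannZetaZeroOrder (ρ : ℂ) : ℝ) *
                ‖(weilMellin g ρ - weilMellin g (1 - conj (ρ : ℂ))) / 2‖ ^ 2) := tsum_mul_left
      _ = _ := by rw [hL.tsum_sub hD]
  linarith

/-- The LINE series is non-negative. [folklore] -/
theorem tsum_line_nonneg (g : ℝ → ℂ) :
    0 ≤ ∑' ρ : ZetaZeros.riemannZetaNontrivialZeros,
        (riemannZetaZeroOrder (ρ : ℂ) : ℝ) *
          ‖(weilMellin g ρ + weilMellin g (1 - conj (ρ : ℂ))) / 2‖ ^ 2 :=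
  tsum_nonneg fun ρ ↦ mul_nonneg (by exact_mod_cast riemannZetaZeroOrder_nonneg (ZetaZeros.riemannZetaNontrivialZeros.ne_one ρ.2) : (0 : ℝ) ≤ riemannZetaZeroOrder (ρ : ℂ)) (sq_nonneg _)

/-- The OFF-LINE series is non-negative. [folklore] -/
theorem tsum_offLine_nonneg (g : ℝ → ℂ) :
    0 ≤ ∑' ρ : ZetaZeros.riemannZetaNontrivialZeros,
        (riemannZetaZeroOrder (ρ : ℂ) : ℝ) *
          ‖(weilMellin g ρ - weilMellin g (1 - conj (ρ : ℂ))) / 2‖ ^ 2 :=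
  tsum_nonneg fun ρ ↦ mul_nonneg (by exact_mod_cast riemannZetaZeroOrder_nonneg (ZetaZeros.riemannZetaNontrivialZeros.ne_one ρ.2) : (0 : ℝ) ≤ riemannZetaZeroOrder (ρ : ℂ)) (sq_nonneg _)

/-- **THE OFF-LINE BUDGET of Weil's form**: for every test function `g`,
`Re Q(g) ≥ −∑_ρ m(ρ) ‖(ĝ(ρ) − ĝ(1−ρ̄))/2‖²`, a series whose terms VANISH at every zero on the
critical line (`weilMellin_sub_reflect_eq_zero`) and are `≤ m(ρ) sinh²(|Re ρ − 1/2| t) (∫‖g‖)²`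
on a window `[−t, t]` (`norm_weilMellin_sub_reflect_le`). In particular under RH the right-hand
side is `0` (the easy half of Weil's criterion), and in general negativity of `Q(g)` can only be
produced by off-line zeros, each weighted by the `sinh`-transform of `g`. [folklore] -/
theorem neg_tsum_le_re_weilQuadratic {g : ℝ → ℂ} (hg : IsWeilTest g) :
    -(∑' ρ : ZetaZeros.riemannZetaNontrivialZeros,
        (riemannZetaZeroOrder (ρ : ℂ) : ℝ) *
          ‖(weilMellin g ρ - weilMellin g (1 - conj (ρ : ℂ))) / 2‖ ^ 2) ≤
      (weilQuadratic g).re := by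
  rw [re_weilQuadratic_eq_tsum_sub_tsum hg]
  linarith [tsum_line_nonneg g]

/-- The complementary upper bound: `Re Q(g) ≤ ∑_ρ m(ρ) ‖(ĝ(ρ) + ĝ(1−ρ̄))/2‖²` (the line series
dominates the form). [folklore] -/
theorem re_weilQuadratic_le_tsum {g : ℝ → ℂ} (hg : IsWeilTest g) :
    (weilQuadratic g).re ≤
      ∑' ρ : ZetaZeros.riemannZetaNontrivialZeros,
        (riemannZetaZeroOrder (ρ : ℂ) : ℝ) *
          ‖(weilMellin g ρ + weilMellin g (1 - conj (ρ : ℂ))) / 2‖ ^ 2 := by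
  rw [re_weilQuadratic_eq_tsum_sub_tsum hg]
  linarith [tsum_offLine_nonneg g]

end Summit.RiemannHypothesis.RiemannHypothesis.Theorems.WeilOffLine

end
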